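import Literature.NumberTheory.DiophantineGeometry.GenEllImageModLContainsSL2
import Literature.NumberTheory.DiophantineGeometry.GenEllPrimesPrescribed
import Literature.NumberTheory.EllipticCurves.BSDSelmerPConverseSerreProofs
import Literature.NumberTheory.GaloisRepresentations.SerreSL2Lifting
import HarnessLib

/-!
# [GenEll] Thm 3.8, final portion: `SL₂(𝔽_l) ⊆ Im` lifts to `SL₂(ℤ/l^n ℤ) ⊆ Im` for all `n` (`l ≥ 5`)

S. Mochizuki, *Arithmetic elliptic curves in general position*, Math. J. Okayama Univ. **52** (2010)
[cite: MochizukiGenEll2010], proof of Theorem 3.8, p. 20, and Lemma 3.1 (iv), p. 14 ("Let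
`J ⊆ GL₂(ℤ_l)` be a closed subgroup whose image `H_J` in `GL₂(𝔽_l)` contains the matrix `α`, as well
as a matrix which is not upper triangular. Then `SL₂(ℤ_l) ⊆ J`" — i.e. J.-P. Serre, *Abelian `l`-adic
representations* (1968), IV §3.4 Lemma 3 / S. Lang, *Elliptic Functions*, Ch. 17 §4: a closed subgroup
of `GL₂(ℤ_l)` whose reduction contains `SL₂(𝔽_l)` contains `SL₂(ℤ_l)`, `l ≥ 5`).

In the tree's level-by-level rendering (`EllPoint.ImageModLContainsSL2 P (l^n)`,
`EllPoint.LAdicImageContainsSL2`, `GenEllFullGalois.lean` / `GenEllPrimesPrescribed.lean`) this is: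

* `EllPoint.exists_map_eq_of_imageModLContainsSL2` — compatibility of a frame of `E[l^{k+1}]` with
  `E[l] = l^k E[l^{k+1}]`: if the image of `Γ_F` in `Aut(E[l])` contains the automorphisms of
  determinant `1`, then every element of `SL₂(𝔽_l)` is the reduction of some `ρ_{l^{k+1}}(σ)` (the
  `SL₂`-analogue of the tree's `exists_map_eq_of_hasSurjectiveModNGaloisRep`, whose construction of
  the `Γ_F`-equivariant bijection `𝔽_l² ≅ E[l]`, `v ↦ e⁻¹(l^k ṽ)`, is reused verbatim);
* `EllPoint.lAdicImageContainsSL2_of_imageModLContainsSL2` — for a prime `l ≥ 5`,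
  `ImageModLContainsSL2 P l → LAdicImageContainsSL2 P l`, by the finite-level Serre–Lang lemma
  `Serre1968.toGL_mem_of_specialLinearGroup_le_map` (tree, `SerreSL2Lifting.lean`);
* `EllPoint.lAdicImageContainsSL2_of_not_admitsLCyclic_of_hasMultiplicativeReductionAt` — the whole
  "final portion" of the proof of Thm. 3.8: no `l`-cyclic subgroup scheme and a prime `v ∤ l` of
  multiplicative reduction with `l ∤ ord_v(Δ_min)`, `l ≥ 5` ⟹ the image of `Gal(Q̄/L) → GL₂(ℤ_l)`
  contains `SL₂(ℤ_l)` (with `GenEllImageModLContainsSL2.lean` for the level-`1` step).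

Proof-only; no definitions; no named-fact hypotheses.
-/

noncomputable section

open scoped Classical MatrixGroups

open WeierstrassCurve Matrix Literature.NumberTheory.EllipticCurves

namespace Literature.NumberTheory.DiophantineGeometry.GenEll

namespace EllPoint

/-- **Frame compatibility, `SL₂` form.**  Let `e : E[l^{k+1}] ≃ (ℤ/l^{k+1})²` be a frame with matrix
representation `ρ` (`e (σ Q) = ρ(σ) · e Q`).  If every `𝔽_l`-linear endomorphism of `E[l]` of
determinant `1` is a Galois element (`ImageModLContainsSL2 P l`), then every `t ∈ SL₂(𝔽_l)` is the
reduction modulo `l` of some `ρ(σ)`.  The bijection `g : 𝔽_l² ≅ E[l]`, `v ↦ e⁻¹(l^k ṽ)`, with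
`σ • g(v) = g((ρ(σ) mod l) · v)` is the one of the tree's `exists_map_eq_of_hasSurjectiveModNGaloisRep`
(Silverman *AEC* III.7: `E[l] = l^k E[l^{k+1}]`); `t` is transported along `g` to a linear
endomorphism of `E[l]` of determinant `det t = 1`. [cite: MochizukiGenEll2010, Lem 3.1 (iv) p.14] -/
theorem exists_map_eq_of_imageModLContainsSL2 (P : EllPoint) (p k : ℕ) [Fact p.Prime]
    (e : P.W.geomTorsion ((p ^ (k + 1) : ℕ) : ℤ) ≃+ (Fin 2 → ZMod (p ^ (k + 1))))
    (ρ : Field.absoluteGaloisGroup P.F →* GL (Fin 2) (ZMod (p ^ (k + 1))))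
    (hρ : ∀ (σ : Field.absoluteGaloisGroup P.F) (Q : P.W.geomTorsion ((p ^ (k + 1) : ℕ) : ℤ)),
      e (σ • Q) = ((ρ σ : GL (Fin 2) (ZMod (p ^ (k + 1)))) :
        Matrix (Fin 2) (Fin 2) (ZMod (p ^ (k + 1)))) *ᵥ e Q)
    (hSL : P.ImageModLContainsSL2 p) (t : SL(2, ZMod p)) :
    ∃ σ : Field.absoluteGaloisGroup P.F,
      Matrix.GeneralLinearGroup.map (ZMod.castHom (dvd_pow_self p k.succ_ne_zero) (ZMod p))
        (ρ σ) = (t : GL (Fin 2) (ZMod p)) := by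
  have hp : p.Prime := Fact.out
  haveI : NeZero (p ^ (k + 1)) := ⟨pow_ne_zero _ hp.ne_zero⟩
  set R := ZMod (p ^ (k + 1)) with hR
  set red : R →+* ZMod p := ZMod.castHom (dvd_pow_self p k.succ_ne_zero) (ZMod p) with hred
  -- `θ : ℤ/p → ℤ/p^(k+1)`, `x ↦ p^k x̃`
  set f : ℤ →+ R := (AddMonoidHom.mulLeft ((p : R) ^ k)).comp (Int.castAddHom R) with hf
  have hf_apply : ∀ x : ℤ, f x = (p : R) ^ k * (x : R) := fun x ↦ rfl
  have hf0 : f (p : ℕ) = 0 := by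
    rw [hf_apply, Int.cast_natCast, ← pow_succ,
      GaloisRepresentations.Serre1968.natCast_pow_eq_zero]
  set θ : ZMod p →+ R := ZMod.lift p ⟨f, hf0⟩ with hθ
  have hθred : ∀ b : R, θ (red b) = (p : R) ^ k * b := fun b ↦ by
    rw [hred, ZMod.castHom_apply, ZMod.cast_eq_val, ← Int.cast_natCast, hθ, ZMod.lift_coe]
    change f _ = _
    rw [hf_apply, Int.cast_natCast, ZMod.natCast_zmod_val]
  have hθmul : ∀ (a : R) (x : ZMod p), a * θ x = θ (red a * x) := fun a x ↦ by
    obtain ⟨b, rfl⟩ := ZMod.ringHom_surjective red x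
    rw [← map_mul, hθred, hθred]
    ring
  have hθp : ∀ x : ZMod p, p • θ x = 0 := fun x ↦ by
    obtain ⟨b, rfl⟩ := ZMod.ringHom_surjective red x
    rw [hθred, nsmul_eq_mul, ← mul_assoc, ← pow_succ',
      GaloisRepresentations.Serre1968.natCast_pow_eq_zero, zero_mul]
  have hθinj : ∀ x : ZMod p, θ x = 0 → x = 0 := fun x hx ↦ by
    obtain ⟨b, rfl⟩ := ZMod.ringHom_surjective red x
    rw [hθred] at hx
    obtain ⟨b', rfl⟩ :=
      GaloisRepresentations.Serre1968.exists_eq_mul_of_pow_mul_eq_zero k.lt_succ_self b hx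
    rw [map_mul, map_natCast, ZMod.natCast_self, zero_mul]
  -- the injection `g : 𝔽_p² → E[p]`, `v ↦ e⁻¹ (θ ∘ v)`
  set lift : (Fin 2 → ZMod p) → P.W.geomTorsion ((p ^ (k + 1) : ℕ) : ℤ) :=
    fun v ↦ e.symm (fun i ↦ θ (v i)) with hlift
  have hlift_mem : ∀ v, ((lift v : P.W.geomTorsion ((p ^ (k + 1) : ℕ) : ℤ)) : P.W.geomPoints) ∈
      P.W.geomTorsion (p : ℤ) := fun v ↦ by
    rw [AddSubgroup.torsionBy.nsmul_iff, ← AddSubmonoidClass.coe_nsmul, hlift, ← map_nsmul]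
    have : p • (fun i ↦ θ (v i)) = 0 := funext fun i ↦ by rw [Pi.smul_apply, hθp, Pi.zero_apply]
    rw [this, map_zero]
    rfl
  set g : (Fin 2 → ZMod p) →+ P.W.geomTorsion (p : ℤ) :=
    { toFun := fun v ↦ ⟨_, hlift_mem v⟩
      map_zero' := by
        apply Subtype.ext
        change ((e.symm fun i ↦ θ ((0 : Fin 2 → ZMod p) i) :
          P.W.geomTorsion ((p ^ (k + 1) : ℕ) : ℤ)) : P.W.geomPoints) = 0
        have : (fun i ↦ θ ((0 : Fin 2 → ZMod p) i)) = 0 := funext fun i ↦ by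
          rw [Pi.zero_apply, map_zero, Pi.zero_apply]
        rw [this, map_zero]
        rfl
      map_add' := fun v w ↦ by
        apply Subtype.ext
        change ((e.symm fun i ↦ θ ((v + w) i) : P.W.geomTorsion ((p ^ (k + 1) : ℕ) : ℤ)) :
            P.W.geomPoints) =
          ((e.symm fun i ↦ θ (v i) : P.W.geomTorsion ((p ^ (k + 1) : ℕ) : ℤ)) : P.W.geomPoints) +
            ((e.symm fun i ↦ θ (w i) : P.W.geomTorsion ((p ^ (k + 1) : ℕ) : ℤ)) : P.W.geomPoints)
        have : (fun i ↦ θ ((v + w) i)) = (fun i ↦ θ (v i)) + fun i ↦ θ (w i) :=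
          funext fun i ↦ by rw [Pi.add_apply, map_add, Pi.add_apply]
        rw [this, map_add, AddSubgroup.coe_add] } with hg
  have hg_coe : ∀ v, ((g v : P.W.geomTorsion (p : ℤ)) : P.W.geomPoints) = (lift v : P.W.geomPoints) :=
    fun v ↦ rfl
  have hginj : Function.Injective g := by
    refine (injective_iff_map_eq_zero g).mpr fun v hv ↦ ?_
    have h1 : ((lift v : P.W.geomTorsion ((p ^ (k + 1) : ℕ) : ℤ)) : P.W.geomPoints) = 0 := by
      rw [← hg_coe, hv]; rfl
    have h2 : lift v = 0 := by exact_mod_cast h1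
    rw [hlift, ← map_zero e.symm] at h2
    have h3 := e.symm.injective h2
    funext i
    exact hθinj _ (congrFun h3 i)
  -- `g` is a bijection, `#E[p] = p²`
  have hcard1 : Nat.card (P.W.geomTorsion (p : ℤ)) = p ^ 2 := P.natCard_geomTorsion_eq_sq p
  haveI : Finite (P.W.geomTorsion (p : ℤ)) :=
    Nat.finite_of_card_ne_zero (by rw [hcard1]; exact pow_ne_zero _ hp.ne_zero)
  have hbij : Function.Bijective g := hginj.bijective_of_nat_card_le (by
    rw [hcard1, Nat.card_fun, Nat.card_zmod, Nat.card_eq_fintype_card, Fintype.card_fin])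
  set gE : (Fin 2 → ZMod p) ≃+ P.W.geomTorsion (p : ℤ) := AddEquiv.ofBijective g hbij with hgE
  -- equivariance: `σ • g v = g ((ρ σ mod p) v)`
  have hequiv : ∀ (σ : Field.absoluteGaloisGroup P.F) (v : Fin 2 → ZMod p),
      σ • g v = g (((Matrix.GeneralLinearGroup.map red (ρ σ) : GL (Fin 2) (ZMod p)) :
        Matrix (Fin 2) (Fin 2) (ZMod p)) *ᵥ v) := by
    intro σ v
    apply Subtype.ext
    rw [AddSubgroup.torsionBy.coe_smul, hg_coe, hg_coe, ← AddSubgroup.torsionBy.coe_smul]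
    have h1 : σ • lift v = e.symm (((ρ σ : GL (Fin 2) R) : Matrix (Fin 2) (Fin 2) R) *ᵥ
        fun i ↦ θ (v i)) := by
      have := congrArg e.symm (hρ σ (lift v))
      rwa [e.symm_apply_apply, hlift, e.apply_symm_apply] at this
    have h2 : (((ρ σ : GL (Fin 2) R) : Matrix (Fin 2) (Fin 2) R) *ᵥ fun i ↦ θ (v i)) =
        fun i ↦ θ ((((Matrix.GeneralLinearGroup.map red (ρ σ) : GL (Fin 2) (ZMod p)) :
          Matrix (Fin 2) (Fin 2) (ZMod p)) *ᵥ v) i) := by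
      have hmap : ∀ i j, ((Matrix.GeneralLinearGroup.map red (ρ σ) : GL (Fin 2) (ZMod p)) :
          Matrix (Fin 2) (Fin 2) (ZMod p)) i j = red (((ρ σ : GL (Fin 2) R) :
            Matrix (Fin 2) (Fin 2) R) i j) := fun i j ↦ rfl
      funext i
      simp only [Matrix.mulVec, dotProduct, Fin.sum_univ_two, map_add, hmap, ← hθmul]
    rw [h1, h2]
  -- transport `t` to a `ZMod p`-LINEAR endomorphism of `E[p]` of determinant `1` and lift it
  letI inst : Module (ZMod p) (P.W.geomTorsion (p : ℤ)) := AddSubgroup.torsionBy.zmodModule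
  set gL : (Fin 2 → ZMod p) ≃ₗ[ZMod p] P.W.geomTorsion (p : ℤ) :=
    { gE.toAddMonoidHom.toZModLinearMap p with
      invFun := gE.symm
      left_inv := fun v => gE.symm_apply_apply v
      right_inv := fun x => gE.apply_symm_apply x } with hgL
  have hgLe : ∀ v, gL v = g v := fun v => (AddEquiv.ofBijective_apply g hbij v)
  set fL : P.W.geomTorsion (p : ℤ) →ₗ[ZMod p] P.W.geomTorsion (p : ℤ) :=
    (gL : _ →ₗ[ZMod p] _) ∘ₗ Matrix.toLin' ((t : SL(2, ZMod p)) : Matrix (Fin 2) (Fin 2) (ZMod p)) ∘ₗ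
      (gL.symm : _ →ₗ[ZMod p] _) with hfL
  have hfLdet : LinearMap.det fL = 1 := by
    rw [hfL, LinearMap.det_conj (Matrix.toLin' ((t : SL(2, ZMod p)) : Matrix (Fin 2) (Fin 2) (ZMod p)))
      gL, LinearMap.det_toLin', Matrix.SpecialLinearGroup.det_coe]
  have hfLg : ∀ v, fL (g v) = g (((t : SL(2, ZMod p)) : Matrix (Fin 2) (Fin 2) (ZMod p)) *ᵥ v) := by
    intro v
    rw [hfL, LinearMap.comp_apply, LinearMap.comp_apply, ← hgLe v, LinearEquiv.coe_coe,
      LinearEquiv.coe_coe, gL.symm_apply_apply, Matrix.toLin'_apply, hgLe]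
  obtain ⟨σ, hσ⟩ := hSL fL hfLdet
  refine ⟨σ, Units.ext (Matrix.ext fun i j ↦ ?_)⟩
  have hv : ∀ v : Fin 2 → ZMod p,
      ((Matrix.GeneralLinearGroup.map red (ρ σ) : GL (Fin 2) (ZMod p)) :
        Matrix (Fin 2) (Fin 2) (ZMod p)) *ᵥ v =
        ((t : SL(2, ZMod p)) : Matrix (Fin 2) (Fin 2) (ZMod p)) *ᵥ v := by
    intro v
    apply hginj
    rw [← hequiv, hσ, hfLg]
  have := congrFun (hv (Pi.single j 1)) i
  rwa [Matrix.mulVec_single_one, Matrix.mulVec_single_one] at this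

/-- **`SL₂(𝔽_l) ⊆ Im ⟹ SL₂(ℤ/l^n) ⊆ Im` for every `n ≥ 1`, `l ≥ 5`** ([GenEll] Lem. 3.1 (iv) /
Serre 1968 IV §3.4 Lemma 3 / Lang, *Elliptic Functions* 17 §4, level by level): frame `E[l^n]`
(`nonempty_addEquiv_geomTorsion`), the framed image `H = ρ(Γ_F) ≤ GL₂(ℤ/l^n)` has reduction
containing `SL₂(𝔽_l)` (`exists_map_eq_of_imageModLContainsSL2`), hence `H ⊇ SL₂(ℤ/l^n)`
(`Serre1968.toGL_mem_of_specialLinearGroup_le_map`); an `ℤ/l^n`-linear endomorphism of `E[l^n]` of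
determinant `1` has an `SL₂`-matrix in the frame, so it is some `σ`. [cite: MochizukiGenEll2010, Lem 3.1 (iv) p.14] -/
theorem lAdicImageContainsSL2_of_imageModLContainsSL2 (P : EllPoint) (l : ℕ) [Fact l.Prime]
    (h5 : 5 ≤ l) (hSL : P.ImageModLContainsSL2 l) : P.LAdicImageContainsSL2 l := by
  intro n hn
  have hl : l.Prime := Fact.out
  obtain ⟨k, rfl⟩ : ∃ k, n = k + 1 := ⟨n - 1, by omega⟩
  have hlF : (l : P.F) ≠ 0 := Nat.cast_ne_zero.mpr hl.ne_zero
  haveI : NeZero (l ^ (k + 1)) := ⟨pow_ne_zero _ hl.ne_zero⟩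
  obtain ⟨e⟩ := nonempty_addEquiv_geomTorsion P.W l (k + 1) k.succ_pos hlF
  obtain ⟨ρ, hρ⟩ := exists_rep_of_addEquiv P.W e
  -- Serre–Lang: `SL₂(ℤ/l^(k+1)) ≤ ρ(Γ_F)`
  have hSLn : ∀ s : SL(2, ZMod (l ^ (k + 1))), (s : GL (Fin 2) (ZMod (l ^ (k + 1)))) ∈ ρ.range :=
    GaloisRepresentations.Serre1968.toGL_mem_of_specialLinearGroup_le_map h5 k.succ_ne_zero ρ.range
      fun t => by
        obtain ⟨σ, hσ⟩ := P.exists_map_eq_of_imageModLContainsSL2 l k e ρ hρ hSL t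
        exact ⟨ρ σ, ⟨σ, rfl⟩, hσ⟩
  -- the predicate at level `l^(k+1)`
  letI inst : Module (ZMod (l ^ (k + 1))) (P.W.geomTorsion ((l ^ (k + 1) : ℕ) : ℤ)) :=
    AddSubgroup.torsionBy.zmodModule
  intro f hf
  set ε : P.W.geomTorsion ((l ^ (k + 1) : ℕ) : ℤ) ≃ₗ[ZMod (l ^ (k + 1))]
      (Fin 2 → ZMod (l ^ (k + 1))) :=
    { e.toAddMonoidHom.toZModLinearMap (l ^ (k + 1)) with
      invFun := e.symm
      left_inv := fun x => e.symm_apply_apply x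
      right_inv := fun x => e.apply_symm_apply x } with hε
  have hεe : ∀ x, ε x = e x := fun x => rfl
  -- the matrix of `f` in the frame
  set B : Matrix (Fin 2) (Fin 2) (ZMod (l ^ (k + 1))) :=
    LinearMap.toMatrix' ((ε : _ →ₗ[ZMod (l ^ (k + 1))] _) ∘ₗ f ∘ₗ
      (ε.symm : _ →ₗ[ZMod (l ^ (k + 1))] _)) with hB
  have hBdet : B.det = 1 := by
    rw [hB, LinearMap.det_toMatrix', LinearMap.det_conj f ε, hf]
  have hBe : ∀ x, B *ᵥ e x = e (f x) := by
    intro x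
    rw [hB, ← Matrix.toLin'_apply, Matrix.toLin'_toMatrix', LinearMap.comp_apply,
      LinearMap.comp_apply, ← hεe, LinearEquiv.coe_coe, LinearEquiv.coe_coe, ε.symm_apply_apply]
    exact hεe (f x)
  obtain ⟨σ, hσ⟩ := hSLn ⟨B, hBdet⟩
  refine ⟨σ, fun x => e.injective ?_⟩
  rw [hρ σ x, hσ, ← hBe x]
  rfl

/-- **[GenEll] Thm. 3.8, final portion, DISCHARGED at all levels**: if `E` admits no `l`-cyclic
subgroup scheme and has a prime `v ∤ l` of multiplicative reduction with `l ∤ ord_v(Δ_min)` (the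
local height), `l ≥ 5`, then the image of `Gal(Q̄/L) → GL₂(ℤ_l)` contains `SL₂(ℤ_l)` — level by
level, `EllPoint.LAdicImageContainsSL2 P l` ("by (P6)-type reasoning at level `1`, and Lemma 3.1 (iv)",
p. 20). [cite: MochizukiGenEll2010, Thm 3.8 p.20] -/
theorem lAdicImageContainsSL2_of_not_admitsLCyclic_of_hasMultiplicativeReductionAt (P : EllPoint)
    (l : ℕ) [Fact l.Prime] (h5 : 5 ≤ l) (hno : ¬ P.AdmitsLCyclic l)
    {v : IsDedekindDomain.HeightOneSpectrum (NumberField.RingOfIntegers P.F)}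
    (hv : P.W.HasMultiplicativeReductionAt v)
    (hvl : (l : NumberField.RingOfIntegers P.F) ∉ v.asIdeal)
    (hndvd : ¬ l ∣ P.W.ordMinimalDiscriminant v) : P.LAdicImageContainsSL2 l :=
  P.lAdicImageContainsSL2_of_imageModLContainsSL2 l h5
    (P.imageModLContainsSL2_of_not_admitsLCyclic_of_hasMultiplicativeReductionAt l hno hv hvl hndvd)

end EllPoint

end Literature.NumberTheory.DiophantineGeometry.GenEll

end
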